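/-
Copyright (c) 2026. All rights reserved.
Released under Apache 2.0 license as described in the file LICENSE.
Authors: abc-iut cell, seat abc-iut-w5-d226 (gen 2; node `AbsTopIII:Lem4.3`, RAF case as a typed reduction).
-/
import Literature.AnabelianGeometry.AbsoluteAnabelian.ArchimedeanSlimnessCAFProofs
import Literature.NumberTheory.EllipticCurves.ShaProofs
import HarnessLib

/-!
# [AbsTopIII] Lemma 4.3 at the model: the RAF case REDUCED to one typed statement, and the
# resulting characterisation of `Lem_4_3`

S. Mochizuki, *Topics in absolute anabelian geometry III*, Lemma 4.3 p. 106 – p. 107 l. 3 (kurims manuscript,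
lit key `paper:url-5493eb38cbb7`; bib key `MochizukiAbsTopIII2015`).  PROOF-ONLY sequel of
`ArchimedeanSlimnessCAFProofs.lean` (CAF case: `G = 1`, `Π_X = Δ_X`).  The printed RAF case: "it suffices
to consider the case where there exists an element `σ ∈ Π_X` that maps to a nontrivial element
`σ_G ∈ G ≅ ℤ/2ℤ` and, moreover, commutes with some open subgroup `H ⊆ Π_X`.  We may assume without loss of
generality that `H ⊆ Δ_X` …" — followed by the `H²(Δ_X, ℚ_l(1))` / first-Chern-class argument showing
that such a `σ` "acts nontrivially on `H²(Δ_X, ℚ_l)`, in contradiction to the fact that `σ` lies in the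
center".  abc-iut-L4-t1's `CurveModel` carries no `H²` `G`-module, so that argument cannot be run at the
model; what this file does is isolate its OUTPUT as ONE typed statement about the extension and prove
that nothing else is needed:

* pure topological group theory (`isSlimGroup_of_isOpen_subgroup`): for an OPEN subgroup `Δ ≤ Π`,
  `Δ` slim ∧ (no element outside `Δ` commutes with a whole `Π`-open subgroup of `Δ`) ⇒ `Π` slim — the
  printed "we may assume `H ⊆ Δ_X`" (open subgroups of `Δ` are cofinal) + "since `Δ_X` is slim, it suffices
  to consider … `σ ∉ Δ`"; with converses (`isSlimGroup_forall_exists_not_commute`, `isSlimGroup_subtype_of_isOpen`);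
* `Field.finite_absoluteGaloisGroup_of_ringEquiv_real`: `Gal(k̄/k)` is FINITE for `k ≃ ℝ` (every
  `k`-automorphism of `k̄` is determined by the sign it gives a square root of `−1`; reuses
  `Literature.NumberTheory.EllipticCurves.algEquiv_apply_eq_self_of_isAlgebraic_real`), whence over an
  RAF base the model's `G` is finite and `Δ_U = ker(Π_U ↠ G)` is OPEN
  (`AbsTopIII.CurveModel.finite_gal_of_RAF`, `FundamentalExtension.isOpen_geom_of_finite_gal`);
* **`AbsTopIII.CurveModel.lem_4_3_RAF_of_noncentral`**: over an RAF base, `Δ_U` slim ∧ "no lift of complex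
  conjugation centralises an open subgroup of `Δ_U`" ⇒ `Π_U` slim;
* **`AbsTopIII.CurveModel.lem_4_3_iff`**: `Lem_4_3 M` ⟺ (geometric slimness at every archimedean curve)
  ∧ (noncentrality of the non-`Δ` elements at every RAF curve) — the strongest honest form of Lemma 4.3
  at the model: its printed inputs ([Mzk20] Prop 2.3 (i); the `H²` computation) are exactly the two
  conjuncts, and conversely `Lem_4_3` implies them.

No new notion or `Prop` fact is declared (the noncentrality clause is spelled out in each statement).
Refereed pre-IUT anabelian geometry; nothing here bears on [IUTchIII] Cor. 3.12 or takes a side.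
-/

set_option autoImplicit false

universe u

/-! ### The absolute Galois group of a real closed field `≃ ℝ` is finite -/

/-- For a field `k ≃ ℝ`, the `k`-automorphism group of `k̄` is finite: a `k`-automorphism of `k̄` is
determined by whether it fixes a chosen square root `j` of `−1` (it then fixes everything,
`Literature.NumberTheory.EllipticCurves.algEquiv_apply_eq_self_of_isAlgebraic_real`) — so there are at most
two of them ("`σ_G ∈ G ≅ ℤ/2ℤ`" in the proof of Lemma 4.3; Serre, *Cohomologie galoisienne* II §6.1).
[cite: MochizukiAbsTopIII2015, Lemma 4.3 p.106] [cite: SerreGaloisCohomology1997, II §6.1] -/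
theorem Field.finite_algEquiv_algebraicClosure_of_ringEquiv_real {k : Type u} [Field k] (e : k ≃+* ℝ) :
    Finite (AlgebraicClosure k ≃ₐ[k] AlgebraicClosure k) := by
  classical
  letI : Algebra ℝ k := e.symm.toRingHom.toAlgebra
  haveI : Algebra.IsAlgebraic ℝ k := ⟨fun x => by
    have hx : x = algebraMap ℝ k (e x) := (e.symm_apply_apply x).symm
    rw [hx]
    exact isAlgebraic_algebraMap (e x)⟩
  obtain ⟨j, hj⟩ := IsAlgClosed.exists_eq_mul_self (-1 : AlgebraicClosure k)
  have hj' : j * j = -1 := hj.symm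
  -- every automorphism fixing `j` is the identity
  have key : ∀ ρ : AlgebraicClosure k ≃ₐ[k] AlgebraicClosure k, ρ j = j → ρ = 1 := fun ρ hρ =>
    AlgEquiv.ext fun x =>
      Literature.NumberTheory.EllipticCurves.algEquiv_apply_eq_self_of_isAlgebraic_real ρ hj' hρ x
  -- every automorphism sends `j` to `± j`
  have hroot : ∀ ρ : AlgebraicClosure k ≃ₐ[k] AlgebraicClosure k, ρ j = j ∨ ρ j = -j := fun ρ => by
    have h : ρ j * ρ j = j * j := by rw [← map_mul, hj', map_neg, map_one]
    exact mul_self_eq_mul_self_iff.mp h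
  refine Finite.of_injective
    (fun σ : AlgebraicClosure k ≃ₐ[k] AlgebraicClosure k => (σ j = j : Prop)) ?_
  intro σ τ h
  have h' : (σ j = j ↔ τ j = j) := Iff.of_eq h
  by_cases hσ : σ j = j
  · rw [key σ hσ, key τ (h'.mp hσ)]
  · have hτ : τ j ≠ j := fun ht => hσ (h'.mpr ht)
    have hσ' : σ j = -j := (hroot σ).resolve_left hσ
    have hτ' : τ j = -j := (hroot τ).resolve_left hτ
    have hfix : (τ⁻¹ * σ) j = j := by
      rw [AlgEquiv.mul_apply, AlgEquiv.aut_inv, hσ']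
      have := τ.symm_apply_apply j
      rw [hτ'] at this
      exact this
    have h1 := key _ hfix
    exact (inv_mul_eq_one.mp h1).symm

/-- **`Gal(k̄/k)` is finite for a field `k ≃ ℝ`** (Mathlib's `Field.absoluteGaloisGroup`; "`G ≅ ℤ/2ℤ`" in the
proof of Lemma 4.3). [cite: MochizukiAbsTopIII2015, Lemma 4.3 p.106] [cite: SerreGaloisCohomology1997, II §6.1] -/
theorem Field.finite_absoluteGaloisGroup_of_ringEquiv_real {k : Type u} [Field k] (e : k ≃+* ℝ) :
    Finite (Field.absoluteGaloisGroup k) := by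
  unfold Field.absoluteGaloisGroup
  exact Field.finite_algEquiv_algebraicClosure_of_ringEquiv_real e

namespace Literature.AnabelianGeometry.AbsoluteAnabelian

open Literature.AlgebraicGeometry.Frobenioids (IsSlimGroup)

/-! ### Slimness from an open subgroup (topological group theory) -/

section OpenSubgroup

variable {P : Type u} [Group P] [TopologicalSpace P]

/-- **Slimness from an open slim subgroup**: if `Δ ≤ Π` is OPEN and slim, and no element of `Π` outside
`Δ` commutes with every element of some `Π`-open subgroup of `Δ`, then `Π` is slim (a centralising
element of an open `H' ≤ Π` centralises the open `H' ∩ Δ ≤ Δ`; inside `Δ` it dies by slimness of `Δ`,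
outside `Δ` by hypothesis — the two cases of the proof of Lemma 4.3).
[cite: MochizukiAbsTopIII2015, Lemma 4.3 p.106] -/
theorem isSlimGroup_of_isOpen_subgroup (Δ : Subgroup P) (hΔo : IsOpen (Δ : Set P))
    (hΔ : IsSlimGroup Δ)
    (hout : ∀ σ : P, σ ∉ Δ → ∀ H : Subgroup P, H ≤ Δ → IsOpen (H : Set P) →
      ∃ h ∈ H, σ * h ≠ h * σ) :
    IsSlimGroup P := by
  refine ⟨fun H' hH' => ?_⟩
  rw [eq_bot_iff]
  intro z hz
  let H : Subgroup P := H' ⊓ Δ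
  have hHo : IsOpen (H : Set P) := by
    change IsOpen ((H' : Set P) ∩ (Δ : Set P))
    exact hH'.inter hΔo
  have hHle : H ≤ Δ := inf_le_right
  have hzH : ∀ h ∈ H, h * z = z * h := fun h hh => (Subgroup.mem_centralizer_iff.mp hz) h hh.1
  by_cases hzΔ : z ∈ Δ
  · -- inside `Δ`: slimness of `Δ` applied to the open subgroup `H ∩ Δ` of `Δ`
    have hK : IsOpen ((H.subgroupOf Δ : Subgroup Δ) : Set Δ) := by
      rw [Subgroup.coe_subgroupOf]
      exact hHo.preimage continuous_subtype_val
    have hc := hΔ.centralizer_eq_bot _ hK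
    have hmem : (⟨z, hzΔ⟩ : Δ) ∈ Subgroup.centralizer ((H.subgroupOf Δ : Subgroup Δ) : Set Δ) := by
      rw [Subgroup.mem_centralizer_iff]
      intro h hh
      exact Subtype.ext (hzH h.1 (Subgroup.mem_subgroupOf.mp hh))
    rw [hc, Subgroup.mem_bot] at hmem
    exact Subgroup.mem_bot.mpr (congrArg Subtype.val hmem)
  · exfalso
    obtain ⟨h, hh, hne⟩ := hout z hzΔ H hHle hHo
    exact hne (hzH h hh).symm

/-- Conversely, in a slim group no element outside ANY subgroup `Δ` commutes with every element of a
`Π`-open subgroup of `Δ` (it would be central for that open subgroup, hence trivial, hence in `Δ`).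
[cite: MochizukiAbsTopIII2015, Lemma 4.3 p.106] -/
theorem isSlimGroup_forall_exists_not_commute (hP : IsSlimGroup P) (Δ : Subgroup P) :
    ∀ σ : P, σ ∉ Δ → ∀ H : Subgroup P, H ≤ Δ → IsOpen (H : Set P) →
      ∃ h ∈ H, σ * h ≠ h * σ := by
  intro σ hσ H _ hHo
  by_contra hall
  have hall' : ∀ h ∈ H, σ * h = h * σ := fun h hh => by
    by_contra hne
    exact hall ⟨h, hh, hne⟩
  have hc : σ ∈ Subgroup.centralizer (H : Set P) := by
    rw [Subgroup.mem_centralizer_iff]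
    intro h hh
    exact (hall' h hh).symm
  rw [hP.centralizer_eq_bot H hHo, Subgroup.mem_bot] at hc
  exact hσ (hc ▸ Δ.one_mem)

/-- An open subgroup of a slim group is slim (open subgroups of an open subgroup are open in the
ambient group). [cite: MochizukiAbsTopIII2015, Lemma 4.3 p.106] -/
theorem isSlimGroup_subtype_of_isOpen (hP : IsSlimGroup P) (Δ : Subgroup P)
    (hΔo : IsOpen (Δ : Set P)) : IsSlimGroup Δ := by
  refine ⟨fun U hU => ?_⟩
  have hUo : IsOpen ((U.map Δ.subtype : Subgroup P) : Set P) := by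
    have h : ((U.map Δ.subtype : Subgroup P) : Set P) = Subtype.val '' (U : Set Δ) := by
      ext x; simp
    rw [h]
    exact hΔo.isOpenMap_subtype_val _ hU
  have hc := hP.centralizer_eq_bot _ hUo
  refine (Subgroup.eq_bot_iff_forall _).mpr fun c hc' => ?_
  have hcP : (c : P) ∈ Subgroup.centralizer ((U.map Δ.subtype : Subgroup P) : Set P) := by
    rw [Subgroup.mem_centralizer_iff]
    rintro _ ⟨u, hu, rfl⟩
    exact congrArg Subtype.val (Subgroup.mem_centralizer_iff.mp hc' u hu)
  rw [hc] at hcP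
  exact Subtype.ext (Subgroup.mem_bot.mp hcP)

end OpenSubgroup

/-! ### The extension `1 → Δ → Π → G → 1` with finite `G` -/

namespace FundamentalExtension

variable (E : FundamentalExtension.{u})

/-- If `G` is finite (e.g. `G = Gal(ℂ/ℝ)`), then `Δ = ker(Π ↠ G)` is OPEN in `Π`.
[cite: MochizukiAbsTopIII2015, Lemma 4.3 p.106] -/
theorem isOpen_geom_of_finite_gal [Finite E.gal] : IsOpen (E.geom : Set E.arith) := by
  have h : (E.geom : Set E.arith) = E.aug ⁻¹' {1} := by
    ext x
    simp [FundamentalExtension.mem_geom]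
  rw [h]
  exact (isOpen_discrete _).preimage (map_continuous E.aug)

end FundamentalExtension

/-! ### Lemma 4.3 at the model: the RAF case and the characterisation -/

namespace AbsTopIII.CurveModel

variable (M : AbsTopIII.CurveModel.{u})

/-- Over a base field that is field-isomorphic to `ℝ`, the Galois group `G = Gal(k̄/k)` of the model's
extension is FINITE ("`G ≅ ℤ/2ℤ`"). [cite: MochizukiAbsTopIII2015, Lemma 4.3 p.106] -/
theorem finite_gal_of_RAF (U : M.Curve) (hk : Nonempty (M.base U ≃+* ℝ)) : Finite (M.ext U).gal := by
  obtain ⟨e⟩ := hk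
  haveI : Finite (Field.absoluteGaloisGroup (M.base U)) :=
    Field.finite_absoluteGaloisGroup_of_ringEquiv_real e
  obtain ⟨i⟩ := nonempty_continuousMulEquiv_of_iso (M.galIso U)
  exact Finite.of_equiv (Field.absoluteGaloisGroup (M.base U))
    (i.symm.toEquiv : Field.absoluteGaloisGroup (M.base U) ≃ (M.ext U).gal)

/-- Over an RAF base, `Δ_U` is open in `Π_U`. [cite: MochizukiAbsTopIII2015, Lemma 4.3 p.106] -/
theorem isOpen_geom_of_RAF (U : M.Curve) (hk : Nonempty (M.base U ≃+* ℝ)) :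
    IsOpen ((M.ext U).geom : Set (M.ext U).arith) := by
  haveI := M.finite_gal_of_RAF U hk
  exact (M.ext U).isOpen_geom_of_finite_gal

/-- **[AbsTopIII] Lemma 4.3, RAF case, reduced**: for a curve `U` of the model over a base field
field-isomorphic to `ℝ`, IF `Δ_U` is slim ("[Mzk20], Proposition 2.3, (i)") AND no `σ ∈ Π_U ∖ Δ_U` (a
lift of complex conjugation) commutes with every element of some `Π_U`-open subgroup of `Δ_U` (the
output of the printed `H²(Δ_X, ℚ_l(1))` argument, p. 106 l. 40 – p. 107 l. 3), THEN `Π_U` is slim.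
[cite: MochizukiAbsTopIII2015, Lemma 4.3 p.106] -/
theorem lem_4_3_RAF_of_noncentral (U : M.Curve) (hk : Nonempty (M.base U ≃+* ℝ))
    (hΔ : IsSlimGroup (M.ext U).geom)
    (hout : ∀ σ : (M.ext U).arith, σ ∉ (M.ext U).geom →
      ∀ H : Subgroup (M.ext U).arith, H ≤ (M.ext U).geom → IsOpen (H : Set (M.ext U).arith) →
        ∃ h ∈ H, σ * h ≠ h * σ) :
    IsSlimGroup (M.ext U).arith :=
  isSlimGroup_of_isOpen_subgroup (M.ext U).geom (M.isOpen_geom_of_RAF U hk) hΔ hout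

/-- **`Lem_4_3 M` from its two printed inputs**: geometric slimness at every archimedean curve and,
at every RAF curve, noncentrality of the non-`Δ` elements.
[cite: MochizukiAbsTopIII2015, Lemma 4.3 p.106] -/
theorem lem_4_3_of_geomSlim_of_noncentral
    (hΔ : ∀ U : M.Curve, (Nonempty (M.base U ≃+* ℂ) ∨ Nonempty (M.base U ≃+* ℝ)) →
      IsSlimGroup (M.ext U).geom)
    (hout : ∀ U : M.Curve, Nonempty (M.base U ≃+* ℝ) →
      ∀ σ : (M.ext U).arith, σ ∉ (M.ext U).geom →
        ∀ H : Subgroup (M.ext U).arith, H ≤ (M.ext U).geom → IsOpen (H : Set (M.ext U).arith) →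
          ∃ h ∈ H, σ * h ≠ h * σ) :
    Lem_4_3 M := by
  intro U hU
  rcases hU with hC | hR
  · exact M.lem_4_3_CAF U hC (hΔ U (Or.inl hC))
  · exact M.lem_4_3_RAF_of_noncentral U hR (hΔ U (Or.inr hR)) (hout U hR)

/-- **Characterisation of Lemma 4.3 at the model**: `Lem_4_3 M` holds iff (a) `Δ_U` is slim for every
curve `U` over an archimedean base ("[Mzk20] Prop 2.3 (i)") and (b) at every RAF curve no element of
`Π_U ∖ Δ_U` commutes with every element of a `Π_U`-open subgroup of `Δ_U` (the `H²` argument's output).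
So the printed proof's two inputs are not only sufficient but NECESSARY for the typed lemma.
[cite: MochizukiAbsTopIII2015, Lemma 4.3 pp.106–107] -/
theorem lem_4_3_iff :
    Lem_4_3 M ↔
      (∀ U : M.Curve, (Nonempty (M.base U ≃+* ℂ) ∨ Nonempty (M.base U ≃+* ℝ)) →
        IsSlimGroup (M.ext U).geom) ∧
      (∀ U : M.Curve, Nonempty (M.base U ≃+* ℝ) →
        ∀ σ : (M.ext U).arith, σ ∉ (M.ext U).geom →
          ∀ H : Subgroup (M.ext U).arith, H ≤ (M.ext U).geom →
            IsOpen (H : Set (M.ext U).arith) → ∃ h ∈ H, σ * h ≠ h * σ) := by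
  constructor
  · intro h
    refine ⟨fun U hU => ?_, fun U hR => isSlimGroup_forall_exists_not_commute (h U (Or.inr hR)) _⟩
    have hPi : IsSlimGroup (M.ext U).arith := h U hU
    have hopen : IsOpen ((M.ext U).geom : Set (M.ext U).arith) := by
      rcases hU with hC | hR
      · rw [M.geom_eq_top_of_CAF U hC]
        exact isOpen_univ
      · exact M.isOpen_geom_of_RAF U hR
    exact isSlimGroup_subtype_of_isOpen hPi _ hopen
  · rintro ⟨hΔ, hout⟩
    exact M.lem_4_3_of_geomSlim_of_noncentral hΔ hout

end AbsTopIII.CurveModel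

end Literature.AnabelianGeometry.AbsoluteAnabelian
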